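import Mathlib.NumberTheory.LSeries.RiemannZeta
import Mathlib.MeasureTheory.Integral.Bochner.Basic
import Literature.NumberTheory.LFunctions.DeBruijnNewman
import HarnessLib

/-!
# Named fact: imaginary zeros of the Laplace transform of the Pólya–de Bruijn kernel imply RH

Grounder file (D-0014 named facts) for the route `RiemannHypothesis/LeeYang`, statement item
stmt-RiemannHypothesis-0452 (`leeyang_assembly`, typed half).

Pólya (1926) / de Bruijn (1950) / Titchmarsh §10.1: with `Φ = Literature.deBruijnPhi` (even, positive,
super-Gaussian decay), `Ξ(z/2)/8 = H_0(z) = ∫₀^∞ Φ(u) cos(zu) du`, so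
`∫_ℝ e^{zu} Φ(u) du = 2 H_0(−iz)` (Φ even). Hence if every zero of the two-sided Laplace
transform `z ↦ ∫_ℝ e^{zu} Φ(u) du` is purely imaginary, `H_0` (equivalently `Ξ`) has only real
zeros, which is the Riemann hypothesis (Titchmarsh §10.1; in-tree facts `Literature.NumberTheory.LFunctions.deBruijnH_zero_eq`,
`Literature.NumberTheory.LFunctions.deBruijnPhi_neg`, `Literature.NumberTheory.LFunctions.riemannHypothesis_iff_hasOnlyRealZeros_deBruijnH_zero`). The
route's assembly item is typed WITHOUT those fact hypotheses, so the composite is recorded here as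
one printed-classical fact.

Nothing is asserted; users take `(h : Literature.riemannHypothesis_of_deBruijnPhi_laplace_zeros)`.

## References

* G. Pólya, *Bemerkung über die Integraldarstellung der Riemannschen ξ-Funktion*, Acta Math. 48
  (1926), 305–317.
* N. G. de Bruijn, Duke Math. J. 17 (1950), 197–226, §1.
* E. C. Titchmarsh, *The Theory of the Riemann Zeta-Function*, 2nd ed., §10.1.
-/

noncomputable section

open Complex MeasureTheory

namespace Literature.NumberTheory.LFunctions

/-- NAMED FACT (Pólya 1926 / de Bruijn 1950 §1 / Titchmarsh §10.1: `Ξ(z/2)/8 = ∫₀^∞ Φ(u) cos(zu) du`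
with `Φ` even, so the zeros of `z ↦ ∫_ℝ e^{zu} Φ(u) du` are `−i ×` the zeros of `Ξ(·/2)`; RH iff
all zeros of `Ξ` are real). If every zero of the two-sided Laplace transform of
`Φ = deBruijnPhi` is purely imaginary, then the Riemann hypothesis holds. Users take
`(h : riemannHypothesis_of_deBruijnPhi_laplace_zeros)`. [cite: Polya1926, integral representation of Ξ (Titchmarsh §10.1)] -/
def riemannHypothesis_of_deBruijnPhi_laplace_zeros : Prop :=
  (∀ z : ℂ, (∫ u : ℝ, Complex.exp (z * u) * (deBruijnPhi u : ℂ)) = 0 → z.re = 0) → RiemannHypothesis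

end Literature.NumberTheory.LFunctions

end
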